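import Summits.Ventures.KdS.TileWindowConstants
import Summits.Ventures.KdS.ConjugationWiring
import HarnessLib

/-!
# Venture KdS — the atlas: box statements over a LIST of certified tiles (wave-1 union theorem shape)

HONEST FRAMING (venture `Summits/Ventures/KdS`, cell `pub-kds`; lead g4 10:20:02Z (4)): bookkeeping. The
box statements `MSTrunc`, `MSTruncScalar`, `MSTrunc0` are pointwise in the parameters (`∀ p ∈ B, …`), so a
wave of tiles is a `List CertTile` of pure DATA (tile, rational table, `η`, and the λ-families filed for
`m ≥ 0`, symmetrised to `m < 0` by `lamSymm` — L5), and the wave theorem is the conjunction over the list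
with the hypotheses sorted into: the cited facts (H1) Casals–Teixeira da Costa 2022 Thm 3.10 and (H3)
Prop. 3.8 (named facts of `Literature/`), the kernel-checked window constants (`∀ t ∈ ts, WindowConstants …`,
supplied per tile by `TilesWave1*.lean` via `windowConstants_of_cert`), and the certificates' Statement B̄
on the `m ≥ 0` half (`CertTile.Data`, the DATA binder = what the signed records state). Nothing is
re-proved when a wave is extended: lists append. No claim about mode stability beyond these implications.
-/

noncomputable section

open Set

namespace Summit.Ventures.KdS

open Literature.Geometry.Lorentzian Literature.Geometry.Lorentzian.KerrDeSitter

/-- A certified tile as PURE DATA: the tile, its standard-shape table, the strip height `η` of the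
record rectangles, and the λ-families (`s = -2`; `s = 0, μ = 1`; `μ = 0`) as filed for `m ≥ 0`. -/
structure CertTile where
  /-- the parameter tile -/
  tile : Tile
  /-- the window table (standard shape, `M0 = 2`) -/
  table : RatTable
  /-- strip height of the record rectangles (`Im ω ≥ −η`) -/
  eta : ℝ
  /-- `Λ□(−2, m)` family, `m ≥ 0` (values at `m < 0` are never used) -/
  rects : ℝ → ℝ → ℂ → ℝ → Set ℂ
  /-- `Λ□(0, m)` family (`μ = 1`), `m ≥ 0` -/
  rectsScalar : ℝ → ℝ → ℂ → ℝ → Set ℂ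

/-- The `WindowTable` of the tile. -/
def CertTile.T (t : CertTile) : WindowTable := t.table.toTable

/-- The symmetrised `s = -2` λ-family (`m < 0` := conjugate images, L5). -/
def CertTile.lam (t : CertTile) : ℝ → ℝ → ℂ → ℝ → Set ℂ := fun a Λ => lamSymm (t.rects a Λ)

/-- The symmetrised scalar λ-family. -/
def CertTile.lamScalar (t : CertTile) : ℝ → ℝ → ℂ → ℝ → Set ℂ :=
  fun a Λ => lamSymm (t.rectsScalar a Λ)

/-- DATA binder, `s = -2`: the signed records' Statement B̄ on the `m ≥ 0` half of the tile's windows. -/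
def CertTile.Data (t : CertTile) : Prop := StatementBbarPos t.tile.box t.T t.eta t.lam

/-- DATA binder, `s = 0`, `μ = 1`. -/
def CertTile.DataScalar (t : CertTile) : Prop := StatementBbarScalarPos t.tile.box t.T t.eta t.lamScalar

/-- The atlas of a list of tiles: the union of their boxes. -/
def atlas (ts : List CertTile) : Set (ℝ × ℝ × ℝ) := {p | ∃ t ∈ ts, p ∈ t.tile.box}

/-! ### Standard-shape tables are even in `m` -/

/-- `R(−m) = R(m)` for the standard shape. -/
theorem RatTable.toTable_R_neg (T : RatTable) (m : ℝ) : T.toTable.R (-m) = T.toTable.R m := by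
  simp [RatTable.toTable, abs_neg, neg_eq_zero]

/-- `h0(−m) = h0(m)` for the standard shape. -/
theorem RatTable.toTable_h0_neg (T : RatTable) (m : ℝ) : T.toTable.h0 (-m) = T.toTable.h0 m := by
  simp [RatTable.toTable, abs_neg]

/-- `S(−m) = S(m)` for the μ = 0 squares. -/
theorem SqTable.toFun_neg (S : SqTable) (m : ℝ) : S.toFun (-m) = S.toFun m := by
  simp [SqTable.toFun, abs_neg, neg_eq_zero]


/-! ### Hypothesis-free scalar window constants from a certificate (lead R2) -/

/-- The rational checks making the scalar window of a standard table contain the disc `|ω| < |m|ϖ₁`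
(`|m| ≤ 2`): `w1hi ≤ R1, h1` and `2·w1hi ≤ R2, h2`. -/
def HorizonCert.ScalarUOK (c : HorizonCert) (t : Tile) (T : RatTable) : Prop :=
  c.w1hi t ≤ T.R1 ∧ c.w1hi t ≤ T.h1 ∧ 2 * c.w1hi t ≤ T.R2 ∧ 2 * c.w1hi t ≤ T.h2

/-- **(H4u) from a certificate**: the scalar window contains the disc `|ω| < |m|ϖ₁`, so the scalar column
needs no cited hypothesis (`msTruncScalarU_of`). -/
theorem windowConstantsScalarU_of_cert {c : HorizonCert} {t : Tile} (hv : c.Valid t) {T : RatTable}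
    (hS : c.ScalarUOK t T) : WindowConstantsScalarU t.box T.toTable := by
  rintro ⟨M, a, Λ⟩ ⟨hM, ha, hΛ⟩
  simp only at hM ha hΛ
  subst hM
  have ha' : t.alo ≤ a ∧ a ≤ t.ahi := ⟨ha.1, ha.2⟩
  have hΛ' : t.Λlo ≤ Λ ∧ Λ ≤ t.Λhi := ⟨hΛ.1, hΛ.2⟩
  obtain ⟨hR1, hh1, hR2, hh2⟩ := hS
  obtain ⟨hsub, -, -, -, -, -⟩ := horizons_of_cert hv ha' hΛ'
  obtain ⟨hw0, hw1⟩ := varpiEvent_le_of_cert hv ha' hΛ'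
  refine ⟨hsub, by linarith [ha.1, hv.1.1], ?_⟩
  intro m hm hm0
  change |m| ≤ 2 at hm
  have hprod : |m| * horizonAngVel a (rPlus 1 a Λ) ≤ 2 * c.w1hi t := mul_le_mul hm hw1 hw0 (by norm_num)
  show |m| * horizonAngVel a (rPlus 1 a Λ) ≤ (if m = 0 then T.R0 else if |m| = 1 then T.R1 else T.R2) ∧
    |m| * horizonAngVel a (rPlus 1 a Λ) ≤ (if |m| = 1 then T.h1 else T.h2)
  constructor
  · split_ifs with h0 h1
    · exact absurd h0 hm0
    · rw [h1, one_mul]; exact hw1.trans hR1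
    · exact hprod.trans hR2
  · split_ifs with h1
    · rw [h1, one_mul]; exact hw1.trans hh1
    · exact hprod.trans hh2

/-! ### One tile -/

/-- Full Statement B̄ of a tile from its DATA binder (L5 wiring). -/
theorem CertTile.statementBbar (t : CertTile) (hd : t.Data) : StatementBbar t.tile.box t.T t.eta t.lam :=
  statementBbar_of_nonneg (RatTable.toTable_R_neg t.table) (fun a Λ => conjSymmNeg_lamSymm (t.rects a Λ)) hd

/-- Full scalar Statement B̄ of a tile from its DATA binder. -/
theorem CertTile.statementBbarScalar (t : CertTile) (hd : t.DataScalar) :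
    StatementBbarScalar t.tile.box t.T t.eta t.lamScalar :=
  statementBbarScalar_of_nonneg (RatTable.toTable_R_neg t.table) (RatTable.toTable_h0_neg t.table)
    (fun a Λ => conjSymmNeg_lamSymm (t.rectsScalar a Λ)) hd

/-! ### A wave = a list of tiles -/

section Wave

variable {ts : List CertTile}

/-- **MS_trunc (`s = -2`) on every tile of the wave**, from (H1), (H3), the kernel-checked window
constants and the DATA binders. -/
theorem msTrunc_atlas (hWC : ∀ t ∈ ts, WindowConstants t.tile.box t.T) (hη : ∀ t ∈ ts, 0 ≤ t.eta)
    (h1 : CasalsTeixeiraDaCosta2022_partialModeStability)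
    (h3 : CasalsTeixeiraDaCosta2022_partialModeStabilityProp38) (hdata : ∀ t ∈ ts, t.Data) :
    ∀ t ∈ ts, MSTrunc t.tile.box t.T t.lam :=
  fun t ht => msTrunc_of_facts' h1 h3 (hWC t ht)
    (statementB_of_bar (hη t ht) (t.statementBbar (hdata t ht)))

/-- **Scalar MS_trunc (`s = 0`, `μ = 1`) on every tile**, from (H1), (H4), (H4s) and the scalar DATA. -/
theorem msTruncScalar_atlas (hWC : ∀ t ∈ ts, WindowConstants t.tile.box t.T)
    (hWCs : ∀ t ∈ ts, WindowConstantsScalar t.tile.box t.T) (hη : ∀ t ∈ ts, 0 ≤ t.eta)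
    (h1 : CasalsTeixeiraDaCosta2022_partialModeStability) (hdata : ∀ t ∈ ts, t.DataScalar) :
    ∀ t ∈ ts, MSTruncScalar t.tile.box t.T t.lamScalar :=
  fun t ht => msTruncScalar_of_facts' h1 (hWC t ht) (hWCs t ht)
    (statementBScalar_of_bar (hη t ht) (t.statementBbarScalar (hdata t ht)))

/-- **Scalar MS_trunc WITHOUT cited hypotheses** on every tile whose scalar window contains the disc
`|ω| < |m|ϖ₁` (`WindowConstantsScalarU`, `SharpWindows.lean`). -/
theorem msTruncScalarU_atlas (hU : ∀ t ∈ ts, WindowConstantsScalarU t.tile.box t.T)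
    (hη : ∀ t ∈ ts, 0 ≤ t.eta) (hdata : ∀ t ∈ ts, t.DataScalar) :
    ∀ t ∈ ts, MSTruncScalar t.tile.box t.T t.lamScalar :=
  fun t ht => msTruncScalarU_of (hU t ht) (hη t ht) (t.statementBbarScalar (hdata t ht))

/-- **The displayed wave theorem, pointwise form (`s = -2`).** For every parameter point of the atlas
there is a tile of the list containing it on which: every mode with `Im ω > 0`, `|m| ≤ 2` has `ω` in
the tile's window `W(m)` only if its separation constant lies outside the tile's (symmetrised)
λ-family — i.e. the λ-truncated no-growing-mode statement — given (H1), (H3), the kernel-checked window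
constants and the certificates' DATA. -/
theorem noMode_atlas (hWC : ∀ t ∈ ts, WindowConstants t.tile.box t.T) (hη : ∀ t ∈ ts, 0 ≤ t.eta)
    (h1 : CasalsTeixeiraDaCosta2022_partialModeStability)
    (h3 : CasalsTeixeiraDaCosta2022_partialModeStabilityProp38) (hdata : ∀ t ∈ ts, t.Data) :
    ∀ p ∈ atlas ts, ∃ t ∈ ts, p ∈ t.tile.box ∧
      NoModeWith p.1 p.2.1 p.2.2 (-2) {q | 0 < q.1.im ∧ |q.2| ≤ 2}
        (fun ω m => {lam | ω ∈ window t.T m → lam ∈ t.lam p.2.1 p.2.2 ω m}) := by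
  rintro p ⟨t, ht, hp⟩
  exact ⟨t, ht, hp, msTrunc_atlas hWC hη h1 h3 hdata t ht p hp⟩

/-- Appending waves: hypotheses over `ts₁ ++ ts₂` split. -/
theorem forall_mem_append_iff {P : CertTile → Prop} {ts₁ ts₂ : List CertTile} :
    (∀ t ∈ ts₁ ++ ts₂, P t) ↔ (∀ t ∈ ts₁, P t) ∧ ∀ t ∈ ts₂, P t := List.forall_mem_append

end Wave

end Summit.Ventures.KdS

end
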